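import Mathlib
import HarnessLib
import Summits.NavierStokesRegularity.NavierStokesRegularity.Theorems.PoloidalWindowDoorLrcModEntireTwistingTHFlatRidgeMixedPin
import Summits.NavierStokesRegularity.NavierStokesRegularity.Theorems.PoloidalWindowDoorLrcModEntireTwistingTHFlatRidgeThirdJet

/-!
# Item `LrcModEntire` (stmt-NavierStokesRegularity-20428) — THE FLAT SUB-CELL: the pressure pins `∂_z p(−1,y) = −N/2` and `∇(∂_z p)(−1,·)(y) = 0` at a flat hot point

ns-k2-port-2 g7, helper of item 20428 under LEAD ns-poloidal-K2-p3 g15 (`--supports stmt-NavierStokesRegularity-20428 --as helper`).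
Memo `Cruxes/LrcModEntire/T2B-g15.md` §16b lists, for the flat sub-cell (κ = 0), the NS-level pins that follow from the vanishing 3-jet of `σv₂(−1,·) − |N|` at a flat hot point
`y` (`…TwistingTHFlatRidgeJet`, `…FlatRidgeCubic`, `…FlatRidgeThirdJet`) and the mixed pin `∇(∂ₜv₂)(−1,·)(y) = 0` (`…FlatRidgeMixedPin`).  Differentiating the vertical momentum
equation `∂ₜv₂ + (v·∇)v₂ = Δv₂ − ∂₂p` in `x` at `(−1,y)`:

* `gradient_pressure_two_of_flatHotPoint` — **`∂₂p(−1,y) = −v₂(−1,0)/2`** for every classical pressure `p` (the hot-point identity `∂₂p = Δv₂ − N/2` of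
  `…HotPointPins.gradient_pressure_two_of_hotPoint` with `Δv₂(−1,·)(y) = 0`);
* ★ `fderiv_gradient_pressure_two_eq_zero_of_flatHotPoint` — **`∇(∂₂p(−1,·))(y) = 0`**: each of `∇(∂ₜv₂)`, `∇((v·∇)v₂) = D²v₂[·,v] + Dv₂∘Dv`, `∇Δv₂` vanishes at `y`.

So on the flat hot web the vertical pressure gradient is pinned to first order (value `−N/2`, critical), for EVERY classical pressure of the profile.

WHAT THIS IS NOT: not a claim about Navier–Stokes regularity and not a proof of `stub_T2b` / `stub_T2bFlat`; point identities for the OPEN flat sub-cell, consistent with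
the (TH) column's `ρ∂_z p = (μ_zz − μ_t)θ − ½μ_zθ² + 2μ_zθ_z − 𝒜` (memo §16b) (bears_on LADDER-NS N0, item 20428 / crux 19708; OPEN).
-/

set_option linter.style.longLine false
set_option linter.dupNamespace false

namespace Summit.NavierStokesRegularity.NavierStokesRegularity.Theorems.PoloidalWindowDoorLrcModEntireTwistingTHFlatRidgePressurePins

open Set Function Filter Topology Metric
open scoped RealInnerProductSpace InnerProductSpace ContDiff Laplacian
open Literature.Analysis Literature.Analysis.FluidPDE Literature.Analysis.UnboundedOperators
open Summit.NavierStokesRegularity.NavierStokesRegularity.Theorems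
open Summit.NavierStokesRegularity.NavierStokesRegularity.Theorems.LocalSineTubeDoorProfileAlignedWindowRigidityAncient
open Summit.NavierStokesRegularity.NavierStokesRegularity.Theorems.PoloidalWindowDoorPoloidalWindowRigidityLocalFrozenLaw
open Summit.NavierStokesRegularity.NavierStokesRegularity.Theorems.PoloidalWindowDoorLrcModEntireThreadPins
open Summit.NavierStokesRegularity.NavierStokesRegularity.Theorems.PoloidalWindowDoorLrcModEntireThreadPressure
open Summit.NavierStokesRegularity.NavierStokesRegularity.Theorems.PoloidalWindowDoorLrcModEntireTwistingTHHotPointPins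
open Summit.NavierStokesRegularity.NavierStokesRegularity.Theorems.PoloidalWindowDoorLrcModEntireTwistingTHFlatRidgeMixedPin
open Summit.NavierStokesRegularity.NavierStokesRegularity.Theorems.PoloidalWindowDoorLrcModEntireTwistingTHFlatRidgeThirdJet

variable {C : ℝ} {v : ℝ → EuclideanSpace ℝ (Fin 3) → EuclideanSpace ℝ (Fin 3)}

/-- **`∂₂p(−1,y) = −v₂(−1,0)/2` at a flat hot point**, for every classical pressure `P` of the profile on `t < 0`. -/
theorem gradient_pressure_two_of_flatHotPoint (hdec : HasTypeITimeDecay C v) (hcont : ContinuousOn (uncurry v) (Iio (0 : ℝ) ×ˢ univ))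
    (hmild : ∀ s t : ℝ, s < t → t < 0 → ∀ x, v t x = heatExtension (v s) (t - s) x - oseenDuhamel 1 s v v t x)
    (hdiv : ∀ t < 0, VectorCalculus.IsDivFree (v t))
    (hTH : ∀ t < 0, ∀ x x' : EuclideanSpace ℝ (Fin 3), x 2 = x' 2 → ∀ b c : Fin 3, b ≠ 2 → c ≠ 2 →
      fderiv ℝ (v t) x (EuclideanSpace.single 2 1) b * fderiv ℝ (v t) x' (EuclideanSpace.single c 1) 2 =
        fderiv ℝ (v t) x' (EuclideanSpace.single 2 1) c * fderiv ℝ (v t) x (EuclideanSpace.single b 1) 2)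
    (hne : v (-1) 0 2 ≠ 0) (hhot : ∀ t < 0, ∀ x, Real.sqrt (-t) * |v t x 2| ≤ |v (-1) 0 2|)
    (hproper : ∀ y ∈ {y : EuclideanSpace ℝ (Fin 3) | y 2 = 0 ∧ v (-1) y 2 = v (-1) 0 2}, ∀ r : ℝ, 0 < r →
      ∃ y' : EuclideanSpace ℝ (Fin 3), y' 2 = 0 ∧ dist y' y < r ∧ v (-1) y' 2 ≠ v (-1) 0 2)
    {σ : ℝ} (hσN : σ * v (-1) 0 2 = |v (-1) 0 2|)
    {y : EuclideanSpace ℝ (Fin 3)} (hy0 : y 2 = 0) (hy : v (-1) y 2 = v (-1) 0 2)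
    (hflat : fderiv ℝ (fderiv ℝ (fun x => σ * v (-1) x 2)) y (EuclideanSpace.single 0 1) (EuclideanSpace.single 0 1) +
      fderiv ℝ (fderiv ℝ (fun x => σ * v (-1) x 2)) y (EuclideanSpace.single 1 1) (EuclideanSpace.single 1 1) = 0)
    {P : ℝ → EuclideanSpace ℝ (Fin 3) → ℝ} (hP : IsClassicalNSSolutionOn (Iio 0) 1 0 v P) :
    gradient (P (-1)) y 2 = -(v (-1) 0 2) / 2 := by
  rw [gradient_pressure_two_of_hotPoint hdec hcont hmild hdiv hne hhot hy hP]
  have hΔ : (Δ (fun x => (v (-1) x 2 : ℝ))) y = 0 :=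
    laplacian_two_eq_zero_of_flatHotPoint hdec hcont hmild hdiv hTH hne hhot hproper hσN hy0 hy hflat
  rw [hΔ]
  ring

/-- The vertical momentum equation of the profile at `t = −1` as an identity of functions of `x`:
`∂₂p(−1,x) = Δv₂(−1,·)(x) − ∂ₜv₂(−1,x) − D(v₂(−1,·))(x)[v(−1,x)]`. -/
theorem gradient_pressure_two_eq {P : ℝ → EuclideanSpace ℝ (Fin 3) → ℝ} (hP : IsClassicalNSSolutionOn (Iio 0) 1 0 v P) :
    (fun x => gradient (P (-1)) x 2) =
      fun x => (Δ (fun x => (v (-1) x 2 : ℝ))) x - deriv (fun s => v s x 2) (-1) - fderiv ℝ (fun x => (v (-1) x 2 : ℝ)) x (v (-1) x) := by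
  have h1 : (-1 : ℝ) ∈ Iio (0 : ℝ) := by norm_num
  have hsm : IsSmoothSpaceTimeOn (Iio 0) v := hP.smooth_velocity
  have hslice : ContDiff ℝ ∞ (v (-1)) := hsm.contDiff_slice h1
  funext x
  have hmom := hP.momentum (-1) h1 x
  rw [one_smul, Pi.zero_apply, Pi.zero_apply, add_zero] at hmom
  have hvec : gradient (P (-1)) x = Δ (v (-1)) x - timeDerivWithin (Iio 0) v (-1) x - convect (v (-1)) (v (-1)) x := by
    have h : timeDerivWithin (Iio 0) v (-1) x + convect (v (-1)) (v (-1)) x + gradient (P (-1)) x = Δ (v (-1)) x := by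
      rw [hmom, sub_add_cancel]
    rw [← h]; abel
  have hcomp := congrArg (fun w : EuclideanSpace ℝ (Fin 3) => w 2) hvec
  simp only [PiLp.sub_apply] at hcomp
  rw [hcomp]
  -- the three coordinates
  have hL : (Δ (v (-1))) x 2 = (Δ (fun x => (v (-1) x 2 : ℝ))) x := laplacian_apply_coord ((hslice.of_le (by norm_cast)).contDiffAt) 2
  have hT : timeDerivWithin (Iio 0) v (-1) x 2 = deriv (fun s => v s x 2) (-1) := by
    rw [timeDerivWithin_eq_deriv isOpen_Iio h1 v x]
    exact deriv_apply_coord (hsm.hasDerivAt_timeLine isOpen_Iio h1 x).differentiableAt 2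
  have hCv : convect (v (-1)) (v (-1)) x 2 = fderiv ℝ (fun x => (v (-1) x 2 : ℝ)) x (v (-1) x) := by
    rw [convect_apply]
    exact (fderiv_apply_coord (v (-1)) ((hslice.differentiable (by simp)) x) (v (-1) x) 2).symm
  rw [hL, hT, hCv]

/-- ★ **`∇(∂₂p(−1,·))(y) = 0` at a flat hot point**, for every classical pressure `P` of the profile on `t < 0`: the vertical pressure gradient is critical on the flat hot web. -/
theorem fderiv_gradient_pressure_two_eq_zero_of_flatHotPoint (hdec : HasTypeITimeDecay C v) (hcont : ContinuousOn (uncurry v) (Iio (0 : ℝ) ×ˢ univ))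
    (hmild : ∀ s t : ℝ, s < t → t < 0 → ∀ x, v t x = heatExtension (v s) (t - s) x - oseenDuhamel 1 s v v t x)
    (hdiv : ∀ t < 0, VectorCalculus.IsDivFree (v t))
    (hTH : ∀ t < 0, ∀ x x' : EuclideanSpace ℝ (Fin 3), x 2 = x' 2 → ∀ b c : Fin 3, b ≠ 2 → c ≠ 2 →
      fderiv ℝ (v t) x (EuclideanSpace.single 2 1) b * fderiv ℝ (v t) x' (EuclideanSpace.single c 1) 2 =
        fderiv ℝ (v t) x' (EuclideanSpace.single 2 1) c * fderiv ℝ (v t) x (EuclideanSpace.single b 1) 2)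
    (hne : v (-1) 0 2 ≠ 0) (hhot : ∀ t < 0, ∀ x, Real.sqrt (-t) * |v t x 2| ≤ |v (-1) 0 2|)
    (hproper : ∀ y ∈ {y : EuclideanSpace ℝ (Fin 3) | y 2 = 0 ∧ v (-1) y 2 = v (-1) 0 2}, ∀ r : ℝ, 0 < r →
      ∃ y' : EuclideanSpace ℝ (Fin 3), y' 2 = 0 ∧ dist y' y < r ∧ v (-1) y' 2 ≠ v (-1) 0 2)
    {σ : ℝ} (hσN : σ * v (-1) 0 2 = |v (-1) 0 2|)
    {y : EuclideanSpace ℝ (Fin 3)} (hy0 : y 2 = 0) (hy : v (-1) y 2 = v (-1) 0 2)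
    (hflat : fderiv ℝ (fderiv ℝ (fun x => σ * v (-1) x 2)) y (EuclideanSpace.single 0 1) (EuclideanSpace.single 0 1) +
      fderiv ℝ (fderiv ℝ (fun x => σ * v (-1) x 2)) y (EuclideanSpace.single 1 1) (EuclideanSpace.single 1 1) = 0)
    {P : ℝ → EuclideanSpace ℝ (Fin 3) → ℝ} (hP : IsClassicalNSSolutionOn (Iio 0) 1 0 v P) :
    fderiv ℝ (fun x => gradient (P (-1)) x 2) y = 0 := by
  have h1 : (-1 : ℝ) ∈ Iio (0 : ℝ) := by norm_num
  have hsm : IsSmoothSpaceTimeOn (Iio 0) v := hP.smooth_velocity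
  have hslice : ContDiff ℝ ∞ (v (-1)) := hsm.contDiff_slice h1
  have hvd : Differentiable ℝ (v (-1)) := hslice.differentiable (by simp)
  set θ : EuclideanSpace ℝ (Fin 3) → ℝ := fun x => v (-1) x 2 with hθdef
  have hθ3 : ContDiff ℝ 3 θ := contDiff_two_component hdec hcont hmild
  have hθd : Differentiable ℝ θ := hθ3.differentiable (by norm_num)
  have hDθd : Differentiable ℝ (fderiv ℝ θ) := (hθ3.fderiv_right (m := 2) (by norm_num)).differentiable (by norm_num)
  rw [gradient_pressure_two_eq hP]
  -- (A) the viscous term: `D(Δθ)(y) = 0`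
  have hA : HasFDerivAt (Δ θ) (0 : EuclideanSpace ℝ (Fin 3) →L[ℝ] ℝ) y := by
    have h := (differentiableAt_laplacian_of_contDiffAt (hθ3.contDiffAt (x := y))).hasFDerivAt
    rwa [fderiv_laplacian_two_eq_zero_of_flatHotPoint hdec hcont hmild hdiv hTH hne hhot hproper hσN hy0 hy hflat] at h
  -- (B) the time derivative: `D(∂ₜv₂(−1,·))(y) = 0` (mixed pin)
  have hB : HasFDerivAt (fun x => deriv (fun s => v s x 2) (-1)) (0 : EuclideanSpace ℝ (Fin 3) →L[ℝ] ℝ) y := by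
    have hθt := (isSmoothSpaceTimeOn_two hdec hcont hmild).isSmoothSpaceTimeOn_deriv isOpen_Iio
    have hd : DifferentiableAt ℝ (fun x => deriv (fun s => v s x 2) (-1)) y := ((hθt.contDiff_slice h1).differentiable (by simp)) y
    have h := hd.hasFDerivAt
    rwa [fderiv_timeDeriv_two_eq_zero_of_flatHotPoint hdec hcont hmild hdiv hTH hne hhot hproper hσN hy0 hy hflat] at h
  -- (C) the convective term: `D(x ↦ Dθ(x)[v(−1,x)])(y) = Dθ(y) ∘ Dv(y) + D²θ(y)[·, v(y)] = 0`
  have hgrad : fderiv ℝ θ y = 0 := by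
    ext h
    rw [hθdef, fderiv_apply_coord (v (-1)) (hvd y) h 2]
    exact gradPin_of_hotPoint hdec hcont hmild hdiv hhot hy h
  have hhess : fderiv ℝ (fderiv ℝ θ) y = 0 := hessian_two_eq_zero_of_flatHotPoint hdec hcont hmild hdiv hTH hne hhot hproper hσN hy0 hy hflat
  have hC : HasFDerivAt (fun x => fderiv ℝ θ x (v (-1) x)) (0 : EuclideanSpace ℝ (Fin 3) →L[ℝ] ℝ) y := by
    have h := ((hDθd y).hasFDerivAt).clm_apply ((hvd y).hasFDerivAt)
    rw [hgrad, hhess] at h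
    simpa using h
  have htot := ((hA.fun_sub hB).fun_sub hC).fderiv
  simp only [sub_zero] at htot
  exact htot

end Summit.NavierStokesRegularity.NavierStokesRegularity.Theorems.PoloidalWindowDoorLrcModEntireTwistingTHFlatRidgePressurePins
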